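import Literature.Analysis.FluidPDE.TaoAnnulusEnstrophyInequality
import Literature.Analysis.FluidPDE.TaoEnstrophyContinuity
import Literature.Analysis.FluidPDE.TaoEnstrophyLocalisationAnnulus
import Literature.Analysis.FluidPDE.TaoBoundedTotalSpeed
import Literature.Analysis.FluidPDE.NSFiniteEnergySmoothProofs
import HarnessLib

/-!
# Tao (2011/2013), Thm. 10.1 for annuli from the nonlinear estimate: assembly of the §10
# argument, and the resulting leaf structure of Cor. 11.1 / Cor. 11.4

This file **proves**

* `NS.tao2011_enstrophyLocalisation_annulus_apriori_unit_of_nonlinearEstimate :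
    tao2011_nonlinearEstimate → tao2011_enstrophyLocalisation_annulus_apriori_unit`,

i.e. Tao 2011, Thm. 10.1 (arXiv:1108.1165, Thm. 59) in the annular form of Remark 10.6 (arXiv
Rem. 64), unit viscosity, with its two global inputs (Prop. 9.1, Lemma 8.1) as hypotheses
(`TaoEnstrophyLocalisationAnnulus.lean`), from the single named fact `tao2011_nonlinearEstimate`
(the estimate for the nonlinear term `Y₆`, `TaoNonlinearEstimate.lean`). The proof is the printed
§10 argument (pp. 30–33) run on the tree's bricks: the speed integral `σ` and the moving Lipschitz
cutoff (`TaoSpeedIntegral`, `TaoMovingCutoff`), the localised enstrophy `W`, the dissipation `Y₁`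
and the integrated kinematic identity (`TaoLocalisedEnstrophy`), the integrated enstrophy
inequality (`TaoAnnulusEnstrophyInequality`), the pigeonhole choice of the radii
`R₁' ∈ [R₁, R₁ + r/4]`, `R₂' ∈ [R₂ − r/4, R₂]` and the heat-flux budget `∫₀ᵀ b ≤ K₁δ²`
(`TaoAnnulusHeatFlux`), the initial bound `W(0) ≤ ½δ²` ((10.16)), the continuity method
(`tao2011_enstrophy_continuity_step_integral`, `TaoEnstrophyContinuity`) and the extraction of the
conclusion on the plateau annulus `B(x₀,R₂−r) \ B(x₀,R₁+r)` where `η = 1` ((10.17)).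

**Constants.** With `K₁ = max K 1` (`K` the constant of the nonlinear estimate; the schema is
monotone in `K`, `tao2011_nonlinearEstimateWith.mono`) and `c₀(K₁)` from the continuity step:
`c = min(c₀, ½, (2K₁)^{-10/9})` (so that `c + K₁c^{9/10} ≤ 1`, the absorption of `Y₄` and of the
`Y₂`-part of `Y₆` into the recession term); `C = max(8/c, 9c^{-1/10}(‖curl‖² + 1))`, so that (10.3)
in the form `C(E + M + δ⁻²) < r` gives `M/c < r/8` (the radii recede by at most `M/c`),
`k⁻¹ = c^{1/10}δ⁻² < r/8` (the ramps have width `k⁻¹`) and `9c^{-1/10}‖curl‖²E < r` (the heat-flux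
budget: `∫₀ᵀ b ≤ (9/2)k‖curl‖²E/r + kε ≤ K₁δ²` with the pigeonhole slack `ε = K₁δ²/(4k)`); and
`A² = 18K₁³e^{2K₁}c^{-1/200}` (the continuity step gives `sup W ≤ 3K₁²e^{2K₁}c^{-1/200}δ²` and
`∫₀ᵀY₁ ≤ 18K₁³e^{2K₁}c^{-1/200}δ²`, and `‖ω‖²_{L²(P)} ≤ 2W`, `‖∇ω‖²_{L²(P)} ≤ Y₁` on the plateau).

**Consequences** (the leaf structure after this file). With the proved passage to the exterior
region, Lemma 8.1 (`tao_finite_energy_smooth_energy_bound_holds`) and the a priori split of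
Prop. 9.1 (`TaoBoundedTotalSpeed`), Cor. 11.1 and all three vendored forms of Cor. 11.4 follow
from exactly **two** named facts — `tao2011_nonlinearEstimate` (§10, `Y₆`) and
`tao2011_duhamelNonlinearSpeed_unit` (§9, the total speed of the nonlinear Duhamel component):
`tao2011_boundedEnstrophy_of_nonlinearEstimate_of_duhamel`,
`tao_unconditional_uniqueness_of_nonlinear_duhamel_leaves`,
`tao_unconditional_uniqueness_velocity_of_nonlinearEstimate_of_duhamel`.

## Mathlib / tree search

`lean search 'annulus_apriori_unit_of|of_nonlinearEstimate'`: no assembly of the annular a priori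
form existed (it was a named fact, consumed by `tao2011_enstrophyLocalisation_exterior_apriori_unit_of_annulus`).
Mathlib: `Real.rpow_le_rpow`, `Real.rpow_mul`, `Real.rpow_neg`, `ofReal_integral_eq_lintegral_ofReal`,
`setLIntegral_mono'`.

## References

* T. Tao, *Localisation and compactness properties of the Navier–Stokes global regularity
  problem*, Anal. PDE 6 (2013) 25–107 = arXiv:1108.1165 (`Tao2011`): Thm. 10.1 and its proof
  (arXiv Thm. 59, §10, pp. 30–33, (10.1)–(10.23)), Remark 10.6 (arXiv Rem. 64, p. 33),
  Prop. 9.1 (arXiv Prop. 52), Lemma 8.1 (arXiv Lemma 44), Cor. 11.1 (arXiv Cor. 68), Cor. 11.4 and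
  Remark 11.3 (arXiv Cor. 71, Rem. 70, p. 36).
-/

noncomputable section

open MeasureTheory Set Function Filter intervalIntegral
open scoped ENNReal NNReal Topology RealInnerProductSpace ContDiff

namespace Literature.Analysis.FluidPDE
section Constants

/-- The Y₆ schema is monotone in its constant: every term it bounds by is nonnegative. [cite: Tao2011, §10, proof of Thm. 10.1 ((10.19)–(10.23))] -/
theorem tao2011_nonlinearEstimateWith.mono {K K' : ℝ} (h : tao2011_nonlinearEstimateWith K)
    (hKK' : K ≤ K') : tao2011_nonlinearEstimateWith K' := by
  intro c δ T E hc hc1 hδ hT hE hsmall u hu hdiv hL2 hint s hs x₀ a b ha hab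
  have h0 := h hc hc1 hδ hT hE hsmall hu hdiv hL2 hint hs x₀ ha hab
  have hs0 : 0 ≤ s := (norm_nonneg _).trans (hs x₀)
  have hη0 : ∀ x, 0 ≤ annularRamp (c ^ (-(1 / 10 : ℝ)) * δ ^ 2) a b ‖x - x₀‖ := fun x =>
    annularRamp_nonneg _ _ _ _
  have hW0 := localisedEnstrophy_nonneg (v := u) hη0
  have hY0 := localisedEnstrophyDissipation_nonneg (v := u) hη0
  have hk0 : 0 ≤ c ^ (-(1 / 10 : ℝ)) * δ ^ 2 := by positivity
  have hI0 : 0 ≤ ∫ x in {x : EuclideanSpace ℝ (Fin 3) |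
      (a < ‖x - x₀‖ ∧ ‖x - x₀‖ < a + (c ^ (-(1 / 10 : ℝ)) * δ ^ 2)⁻¹) ∨
        (b - (c ^ (-(1 / 10 : ℝ)) * δ ^ 2)⁻¹ < ‖x - x₀‖ ∧ ‖x - x₀‖ < b)}, ‖FluidPDE.curl u x‖ ^ 2 :=
    setIntegral_nonneg (measurableSet_layers x₀ _ a b) fun x _ => sq_nonneg _
  have hA : 0 ≤ c ^ (-(3 / 20 : ℝ)) * δ ^ 3 *
      (localisedEnstrophy (fun x => annularRamp (c ^ (-(1 / 10 : ℝ)) * δ ^ 2) a b ‖x - x₀‖) u *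
        Real.sqrt (localisedEnstrophy (fun x => annularRamp (c ^ (-(1 / 10 : ℝ)) * δ ^ 2) a b ‖x - x₀‖) u)) +
      c ^ (1 / 20 : ℝ) * δ⁻¹ *
        (Real.sqrt (localisedEnstrophy (fun x => annularRamp (c ^ (-(1 / 10 : ℝ)) * δ ^ 2) a b ‖x - x₀‖) u) *
          localisedEnstrophyDissipation (fun x => annularRamp (c ^ (-(1 / 10 : ℝ)) * δ ^ 2) a b ‖x - x₀‖) u) +
      c ^ (3 / 4 : ℝ) * localisedEnstrophy (fun x => annularRamp (c ^ (-(1 / 10 : ℝ)) * δ ^ 2) a b ‖x - x₀‖) u / T := by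
    positivity
  have hB : 0 ≤ c ^ (9 / 10 : ℝ) * ((c ^ (-(1 / 10 : ℝ)) * δ ^ 2) / (2 * c) * s *
      ∫ x in {x : EuclideanSpace ℝ (Fin 3) |
        (a < ‖x - x₀‖ ∧ ‖x - x₀‖ < a + (c ^ (-(1 / 10 : ℝ)) * δ ^ 2)⁻¹) ∨
          (b - (c ^ (-(1 / 10 : ℝ)) * δ ^ 2)⁻¹ < ‖x - x₀‖ ∧ ‖x - x₀‖ < b)}, ‖FluidPDE.curl u x‖ ^ 2) := by
    positivity
  nlinarith [mul_le_mul_of_nonneg_right hKK' hA, mul_le_mul_of_nonneg_right hKK' hB]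

/-- The absorption constant: for `K₁ ≥ 1` and `0 < c ≤ (2K₁)^{-10/9}` one has `K₁ c^{9/10} ≤ ½`. [folklore] -/
theorem mul_rpow_nine_tenths_le_half {K₁ c : ℝ} (hK : 1 ≤ K₁) (hc : 0 < c)
    (hcle : c ≤ (2 * K₁) ^ (-(10 / 9 : ℝ))) : K₁ * c ^ (9 / 10 : ℝ) ≤ 1 / 2 := by
  have h2K : 0 < 2 * K₁ := by linarith
  have h1 : c ^ (9 / 10 : ℝ) ≤ ((2 * K₁) ^ (-(10 / 9 : ℝ))) ^ (9 / 10 : ℝ) :=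
    Real.rpow_le_rpow hc.le hcle (by norm_num)
  rw [← Real.rpow_mul h2K.le, show (-(10 / 9 : ℝ)) * (9 / 10) = -1 by norm_num,
    Real.rpow_neg_one] at h1
  calc K₁ * c ^ (9 / 10 : ℝ) ≤ K₁ * (2 * K₁)⁻¹ := mul_le_mul_of_nonneg_left h1 (by linarith)
    _ = 1 / 2 := by field_simp

end Constants

section Assembly

-- The §10 assembly is one long bookkeeping proof (constants, radii, pigeonhole, continuity method,
-- extraction: ~260 tactic lines); it elaborates well within 8× the default heartbeat budget.
set_option maxHeartbeats 1600000 in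
/-- **Tao 2011, Thm. 10.1 for annuli (Remark 10.6), a priori form, unit viscosity — from the
nonlinear estimate.** The §10 argument assembled from the tree's proved bricks: the speed
integral and the moving Lipschitz cutoff (`TaoSpeedIntegral`, `TaoMovingCutoff`), the localised
enstrophy and the integrated kinematic identity (`TaoLocalisedEnstrophy`), the enstrophy identity
(10.11) (`TaoEnstrophyIdentity`), the heat-flux bound `Y₃ ≲ b(t)` (`TaoHeatFlux`) with the
pigeonhole choice of the radii `R₁' ∈ [R₁, R₁ + r/4]`, `R₂' ∈ [R₂ − r/4, R₂]`
(`exists_radius_intervalIntegral_sphereTerm_le`), the transport bound `|Y₄| ≲ cY₂`, the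
vendored nonlinear estimate for `Y₆` (`tao2011_nonlinearEstimate`, the only unproved input),
and the continuity method (`tao2011_enstrophy_continuity_step_integral`). Constants: with `K₁ =
max K 1` (`K` the constant of the nonlinear estimate) and `c₀(K₁)` from the continuity step,
`c = min(c₀, ½, (2K₁)^{-10/9})` (so that `c + K₁c^{9/10} ≤ 1`), `C = max(8/c,
9c^{-1/10}(‖curl‖² + 1))` (so that `M/c, k⁻¹ < r/8` and the heat-flux budget is `≤ K₁δ²`), and
`A² = 18K₁³e^{2K₁}c^{-1/200}`. [cite: Tao2011, Thm. 10.1 + Remark 10.6 (proof, §10, pp. 30–33)] -/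
theorem tao2011_enstrophyLocalisation_annulus_apriori_unit_of_nonlinearEstimate
    (hY : tao2011_nonlinearEstimate) : tao2011_enstrophyLocalisation_annulus_apriori_unit := by
  obtain ⟨K, -, hYK⟩ := hY
  set K₁ : ℝ := max K 1 with hK₁def
  have hK₁ : 1 ≤ K₁ := le_max_right _ _
  have hK₁0 : 0 < K₁ := one_pos.trans_le hK₁
  have hY₁ : tao2011_nonlinearEstimateWith K₁ := hYK.mono (le_max_left _ _)
  obtain ⟨c₀, hc₀, -, hstep⟩ := tao2011_enstrophy_continuity_step_integral hK₁
  set c : ℝ := min c₀ (min (1 / 2) ((2 * K₁) ^ (-(10 / 9 : ℝ)))) with hcdef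
  have hc : 0 < c := lt_min hc₀ (lt_min (by norm_num) (Real.rpow_pos_of_pos (by linarith) _))
  have hcc₀ : c ≤ c₀ := min_le_left _ _
  have hc12 : c ≤ 1 / 2 := (min_le_right _ _).trans (min_le_left _ _)
  have hc1 : c ≤ 1 := by linarith
  have hcK : c ≤ (2 * K₁) ^ (-(10 / 9 : ℝ)) := (min_le_right _ _).trans (min_le_right _ _)
  have habs : c + K₁ * c ^ (9 / 10 : ℝ) ≤ 1 := by
    have := mul_rpow_nine_tenths_le_half hK₁ hc hcK; linarith
  set κ2 : ℝ := ‖FluidPDE.curlCLM‖ ^ 2 with hκ2def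
  have hκ2 : 0 ≤ κ2 := sq_nonneg _
  set C : ℝ := max (8 / c) (9 * c ^ (-(1 / 10 : ℝ)) * (κ2 + 1)) with hCdef
  have hC8c : 8 / c ≤ C := le_max_left _ _
  have hC9 : 9 * c ^ (-(1 / 10 : ℝ)) * (κ2 + 1) ≤ C := le_max_right _ _
  have hC0 : 0 < C := lt_of_lt_of_le (by positivity) hC8c
  set L : ℝ := 18 * K₁ ^ 3 * Real.exp (2 * K₁) * c ^ (-(1 / 200 : ℝ)) with hLdef
  have hL0 : 0 < L := by positivity
  have hL6 : 2 * (3 * K₁ ^ 2 * Real.exp (2 * K₁) * c ^ (-(1 / 200 : ℝ))) ≤ L := by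
    rw [hLdef]
    have h1 : K₁ ^ 2 ≤ K₁ ^ 3 := by nlinarith
    have h2 : 0 ≤ Real.exp (2 * K₁) * c ^ (-(1 / 200 : ℝ)) := by positivity
    nlinarith
  set A : ℝ := Real.sqrt L with hAdef
  have hA0 : 0 < A := Real.sqrt_pos.2 hL0
  have hA2 : ∀ δ : ℝ, (A * δ) ^ 2 = L * δ ^ 2 := fun δ => by
    rw [mul_pow, hAdef, Real.sq_sqrt hL0.le]
  refine ⟨c, C, A, hc, hC0, hA0, ?_⟩
  intro T hT u p hsol E M hE hM hEt hD hMt x₀ R₁ R₂ r δ hδ hr hrR₁ hrR₂ hω₀ hsmall hlarge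
  have hu := hsol.smooth_velocity
  -- the slope `k = c^{-1/10} δ²` and the width `k⁻¹ = c^{1/10} δ⁻² ≤ δ⁻²`
  set k : ℝ := c ^ (-(1 / 10 : ℝ)) * δ ^ 2 with hk
  have hk0 : 0 < k := by positivity
  have hki : 0 < k⁻¹ := inv_pos.2 hk0
  have hkinv : k⁻¹ ≤ δ⁻¹ ^ 2 := by
    rw [hk, mul_inv, Real.rpow_neg hc.le, inv_inv, inv_pow]
    have h1 : c ^ (1 / 10 : ℝ) ≤ 1 := Real.rpow_le_one hc.le hc1 (by norm_num)
    have h2 : 0 ≤ (δ ^ 2)⁻¹ := by positivity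
    calc c ^ (1 / 10 : ℝ) * (δ ^ 2)⁻¹ ≤ 1 * (δ ^ 2)⁻¹ := mul_le_mul_of_nonneg_right h1 h2
      _ = (δ ^ 2)⁻¹ := one_mul _
  -- consequences of (10.3): `M/c < r/8`, `k⁻¹ < r/8`, `9 c^{-1/10} κ² E < r`
  have hδ2 : 0 ≤ δ⁻¹ ^ 2 := by positivity
  have hCM : C * M < r :=
    (mul_le_mul_of_nonneg_left (by linarith only [hE, hδ2]) hC0.le).trans_lt hlarge
  have hCE : C * E < r :=
    (mul_le_mul_of_nonneg_left (by linarith only [hM, hδ2]) hC0.le).trans_lt hlarge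
  have hCδ : C * δ⁻¹ ^ 2 < r :=
    (mul_le_mul_of_nonneg_left (by linarith only [hM, hE]) hC0.le).trans_lt hlarge
  have hMr : M / c < r / 8 := by
    have h1 : 8 / c * M ≤ C * M := mul_le_mul_of_nonneg_right hC8c hM
    rw [div_mul_eq_mul_div] at h1
    rw [div_lt_div_iff₀ hc (by norm_num : (0:ℝ) < 8)]
    have h2 : 8 * M / c < r := h1.trans_lt hCM
    rw [div_lt_iff₀ hc] at h2
    linarith
  have hℓr : k⁻¹ < r / 8 := by
    have h1c : 1 ≤ 1 / c := by rw [le_div_iff₀ hc]; linarith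
    have h1 : 8 * k⁻¹ ≤ 8 / c * δ⁻¹ ^ 2 := by
      calc 8 * k⁻¹ ≤ 8 * δ⁻¹ ^ 2 := by linarith
        _ = 8 * 1 * δ⁻¹ ^ 2 := by ring
        _ ≤ 8 * (1 / c) * δ⁻¹ ^ 2 := by gcongr
        _ = 8 / c * δ⁻¹ ^ 2 := by ring
    have h2 : 8 / c * δ⁻¹ ^ 2 ≤ C * δ⁻¹ ^ 2 := mul_le_mul_of_nonneg_right hC8c hδ2
    linarith
  have hEr : 9 * c ^ (-(1 / 10 : ℝ)) * κ2 * E < r := by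
    have h1 : 9 * c ^ (-(1 / 10 : ℝ)) * κ2 * E ≤ 9 * c ^ (-(1 / 10 : ℝ)) * (κ2 + 1) * E := by
      have : 0 ≤ 9 * c ^ (-(1 / 10 : ℝ)) * E := by positivity
      nlinarith
    have h2 : 9 * c ^ (-(1 / 10 : ℝ)) * (κ2 + 1) * E ≤ C * E := mul_le_mul_of_nonneg_right hC9 hE
    linarith
  -- dissipation in the form without the unit viscosity factor, and (10.2)
  have hD' : ∫⁻ t in Ioo 0 T, ∫⁻ x, ENNReal.ofReal (FluidPDE.frobeniusNormSq (fderiv ℝ (u t) x)) ≤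
      ENNReal.ofReal E := by rwa [ENNReal.ofReal_one, one_mul] at hD
  have hsmallE : δ ^ 5 * Real.sqrt E * T ≤ c := by
    have : 0 ≤ δ ^ 4 * T := by positivity
    linarith
  have hδ4T : δ ^ 4 * T ≤ c := by
    have : 0 ≤ δ ^ 5 * Real.sqrt E * T := by positivity
    linarith
  -- the speed integral
  have hσ0 : ∀ s ∈ Icc 0 T, 0 ≤ speedIntegral u s := fun s hs => speedIntegral_nonneg hT hu hMt hs
  have hσM : ∀ s ∈ Icc 0 T, speedIntegral u s ≤ M := fun s hs => speedIntegral_le_of_mem hT hM hu hMt hs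
  have hσc : ContinuousOn (fun τ => speedIntegral u τ / c) (Icc 0 T) :=
    (continuousOn_speedIntegral hT hu hMt).div_const c
  have hσcM : ∀ s ∈ Icc 0 T, speedIntegral u s / c ≤ M / c := fun s hs =>
    div_le_div_of_nonneg_right (hσM s hs) hc.le
  have hσc0 : ∀ s ∈ Icc 0 T, 0 ≤ speedIntegral u s / c := fun s hs => div_nonneg (hσ0 s hs) hc.le
  have hσ00 : speedIntegral u 0 = 0 := by rw [speedIntegral_def, intervalIntegral.integral_same]
  -- geometry of the radii
  have hR₁0 : 0 < R₁ := by linarith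
  have hR₂R₁ : R₁ + 2 * r < R₂ := by linarith
  -- pigeonhole choice of the two radii
  set ε : ℝ := K₁ * δ ^ 2 / (4 * k) with hεdef
  have hε : 0 < ε := by positivity
  obtain ⟨R₁', hR₁'mem, hT₁⟩ := exists_radius_intervalIntegral_sphereTerm_le hT hu hE hD' x₀ hσc
    (α := R₁) (β := R₁ + r / 4) (by linarith) (fun τ hτ => by linarith [hσc0 τ hτ]) hε
  obtain ⟨R₂', hR₂'mem, hT₂⟩ := exists_radius_intervalIntegral_sphereTerm_sub_le hT hu hE hD' x₀ hσc
    (α := R₂ - r / 4) (β := R₂) (by linarith) (fun τ hτ => by linarith [hσcM τ hτ]) hε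
  rw [show R₁ + r / 4 - R₁ = r / 4 by ring] at hT₁
  rw [show R₂ - (R₂ - r / 4) = r / 4 by ring] at hT₂
  have hR₁' : 0 < R₁' := hR₁0.trans_le hR₁'mem.1
  have hgap : R₁' + M / c + 2 * k⁻¹ < R₂' - M / c := by
    linarith [hR₁'mem.2, hR₂'mem.1]
  -- the integrated enstrophy inequality along the moving cutoff
  have hineq := fun t (ht : t ∈ Icc 0 T) => localisedEnstrophy_add_intervalIntegral_le hT hsol hK₁ hc
    hc1 hδ hE hM hk habs hY₁ hsmallE hEt hMt x₀ hR₁' hgap ht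
  -- continuity of W, Y₁, b on [0, T]
  obtain ⟨hρ₁c, hρ₂c⟩ := continuousOn_speedRadii hT hu hMt c R₁' R₂'
  have hρ₂le : ∀ s ∈ Icc 0 T, R₂' - speedIntegral u s / c ≤ R₂' := fun s hs => by
    linarith [hσc0 s hs]
  have hWc := continuousOn_localisedEnstrophy_movingCutoff (x₀ := x₀) hT hsol hk0.le hρ₁c hρ₂c hρ₂le
  have hYc := continuousOn_localisedEnstrophyDissipation_movingCutoff (x₀ := x₀) hT hsol hk0.le hρ₁c
    hρ₂c hρ₂le
  have hbc := continuousOn_heatFluxMajorant (k := k) (c := c) (R₂' := R₂') hT hsol hMt x₀ hR₁'.le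
  -- nonnegativity
  have hW0' : ∀ t ∈ Icc 0 T, 0 ≤ (fun s => localisedEnstrophy (movingCutoff x₀ k (fun t => R₁' + speedIntegral u t / c) (fun t => R₂' - speedIntegral u t / c) s) (u s)) t := fun t _ =>
    localisedEnstrophy_nonneg (movingCutoff_nonneg x₀ k _ _ t) _
  have hY0' : ∀ t ∈ Icc 0 T, 0 ≤ (fun s => localisedEnstrophyDissipation (movingCutoff x₀ k (fun t => R₁' + speedIntegral u t / c) (fun t => R₂' - speedIntegral u t / c) s) (u s)) t := fun t _ =>
    localisedEnstrophyDissipation_nonneg (movingCutoff_nonneg x₀ k _ _ t) _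
  have hshell0 : ∀ t, 0 ≤ ∫ x in {x : EuclideanSpace ℝ (Fin 3) | R₁' < ‖x - x₀‖ ∧ ‖x - x₀‖ < R₂'},
      ‖FluidPDE.curl (u t) x‖ ^ 2 := fun t =>
    setIntegral_nonneg (measurableSet_shell_centre x₀ _ _) fun x _ => sq_nonneg _
  have hb0' : ∀ t ∈ Icc 0 T, 0 ≤ (fun s => k / 2 * ((R₁' + speedIntegral u s / c) ^ 2 *
            sphereNormSq (FluidPDE.curl (u s)) x₀ (R₁' + speedIntegral u s / c) +
            (R₂' - speedIntegral u s / c) ^ 2 *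
              sphereNormSq (FluidPDE.curl (u s)) x₀ (R₂' - speedIntegral u s / c)) +
          k / R₁' * ∫ x in {x : EuclideanSpace ℝ (Fin 3) | R₁' < ‖x - x₀‖ ∧ ‖x - x₀‖ < R₂'},
            ‖FluidPDE.curl (u s) x‖ ^ 2) t := fun t _ => by
    have h1 := hshell0 t
    have h2 := sphereNormSq_nonneg (FluidPDE.curl (u t)) x₀ (R₁' + speedIntegral u t / c)
    have h3 := sphereNormSq_nonneg (FluidPDE.curl (u t)) x₀ (R₂' - speedIntegral u t / c)
    have hk2 : 0 ≤ k / 2 := by positivity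
    have hkR : 0 ≤ k / R₁' := by positivity
    exact add_nonneg (mul_nonneg hk2 (add_nonneg (mul_nonneg (sq_nonneg _) h2)
      (mul_nonneg (sq_nonneg _) h3))) (mul_nonneg hkR h1)
  -- the initial bound W(0) ≤ δ²/2 ≤ K₁ δ²
  have hW0K : (fun s => localisedEnstrophy (movingCutoff x₀ k (fun t => R₁' + speedIntegral u t / c) (fun t => R₂' - speedIntegral u t / c) s) (u s)) 0 ≤ K₁ * δ ^ 2 := by
    have hS : MeasurableSet (Metric.ball x₀ R₂ \ Metric.ball x₀ R₁) :=
      measurableSet_ball.diff measurableSet_ball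
    have hsub : Metric.ball x₀ (R₂' - speedIntegral u 0 / c) \
        Metric.closedBall x₀ (R₁' + speedIntegral u 0 / c) ⊆ Metric.ball x₀ R₂ \ Metric.ball x₀ R₁ := by
      intro x hx
      rw [hσ00, zero_div, sub_zero, add_zero] at hx
      rw [Set.mem_sdiff, Metric.mem_ball, Metric.mem_closedBall, not_le] at hx
      rw [Set.mem_sdiff, Metric.mem_ball, Metric.mem_ball, not_lt]
      exact ⟨hx.1.trans_le hR₂'mem.2, hR₁'mem.1.trans hx.2.le⟩
    have h := localisedEnstrophy_movingCutoff_le_of_setLIntegral_le (x₀ := x₀) (k := k)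
      (ρ₁ := fun t => R₁' + speedIntegral u t / c) (ρ₂ := fun t => R₂' - speedIntegral u t / c)
      hk0.le (t := 0) hS hsub (v := u 0) (sq_nonneg δ) hω₀
    have h2 : δ ^ 2 / 2 ≤ K₁ * δ ^ 2 := by nlinarith [sq_nonneg δ]
    exact h.trans h2
  -- the heat-flux budget ∫₀ᵀ b ≤ K₁ δ²
  have hIb : ∫ t in (0)..T, (fun s => k / 2 * ((R₁' + speedIntegral u s / c) ^ 2 *
            sphereNormSq (FluidPDE.curl (u s)) x₀ (R₁' + speedIntegral u s / c) +
            (R₂' - speedIntegral u s / c) ^ 2 *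
              sphereNormSq (FluidPDE.curl (u s)) x₀ (R₂' - speedIntegral u s / c)) +
          k / R₁' * ∫ x in {x : EuclideanSpace ℝ (Fin 3) | R₁' < ‖x - x₀‖ ∧ ‖x - x₀‖ < R₂'},
            ‖FluidPDE.curl (u s) x‖ ^ 2) t ≤ K₁ * δ ^ 2 := by
    have hs₁ := continuousOn_sq_mul_sphereNormSq_curl hT hu x₀ hρ₁c
    have hs₂ := continuousOn_sq_mul_sphereNormSq_curl hT hu x₀ hρ₂c
    have hsh := continuousOn_setIntegral_shell_curl_sq hT hu x₀ (a := R₁') (b := R₂') hR₁'.le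
    have i₁ := hs₁.intervalIntegrable_of_Icc (μ := volume) hT.le
    have i₂ := hs₂.intervalIntegrable_of_Icc (μ := volume) hT.le
    have ish := hsh.intervalIntegrable_of_Icc (μ := volume) hT.le
    have hsplit : ∫ t in (0)..T, (fun s => k / 2 * ((R₁' + speedIntegral u s / c) ^ 2 *
            sphereNormSq (FluidPDE.curl (u s)) x₀ (R₁' + speedIntegral u s / c) +
            (R₂' - speedIntegral u s / c) ^ 2 *
              sphereNormSq (FluidPDE.curl (u s)) x₀ (R₂' - speedIntegral u s / c)) +
          k / R₁' * ∫ x in {x : EuclideanSpace ℝ (Fin 3) | R₁' < ‖x - x₀‖ ∧ ‖x - x₀‖ < R₂'},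
            ‖FluidPDE.curl (u s) x‖ ^ 2) t =
        k / 2 * ((∫ t in (0)..T, (R₁' + speedIntegral u t / c) ^ 2 *
            sphereNormSq (FluidPDE.curl (u t)) x₀ (R₁' + speedIntegral u t / c)) +
          ∫ t in (0)..T, (R₂' - speedIntegral u t / c) ^ 2 *
            sphereNormSq (FluidPDE.curl (u t)) x₀ (R₂' - speedIntegral u t / c)) +
        k / R₁' * ∫ t in (0)..T, ∫ x in {x : EuclideanSpace ℝ (Fin 3) | R₁' < ‖x - x₀‖ ∧ ‖x - x₀‖ < R₂'},
            ‖FluidPDE.curl (u t) x‖ ^ 2 := by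
      simp only []
      rw [intervalIntegral.integral_add ((i₁.add i₂).const_mul _) (ish.const_mul _),
        intervalIntegral.integral_const_mul, intervalIntegral.integral_const_mul,
        intervalIntegral.integral_add i₁ i₂]
    have hshT := intervalIntegral_setIntegral_shell_curl_sq_le hT hu hE hD' x₀ (a := R₁') (b := R₂') hR₁'.le
    rw [hsplit]
    -- arithmetic
    have hkε : k * ε = K₁ * δ ^ 2 / 4 := by rw [hεdef]; field_simp
    have hR₁'2r : 2 * r < R₁' := by linarith [hR₁'mem.1]
    have h1 : k / R₁' * ∫ t in (0)..T, ∫ x in {x : EuclideanSpace ℝ (Fin 3) | R₁' < ‖x - x₀‖ ∧ ‖x - x₀‖ < R₂'},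
        ‖FluidPDE.curl (u t) x‖ ^ 2 ≤ k / (2 * r) * (κ2 * E) := by
      have ha : k / R₁' ≤ k / (2 * r) := div_le_div_of_nonneg_left hk0.le (by positivity) hR₁'2r.le
      have hI0 : 0 ≤ ∫ t in (0)..T, ∫ x in {x : EuclideanSpace ℝ (Fin 3) | R₁' < ‖x - x₀‖ ∧ ‖x - x₀‖ < R₂'},
          ‖FluidPDE.curl (u t) x‖ ^ 2 := intervalIntegral.integral_nonneg hT.le fun t _ => hshell0 t
      calc k / R₁' * ∫ t in (0)..T, ∫ x in {x : EuclideanSpace ℝ (Fin 3) | R₁' < ‖x - x₀‖ ∧ ‖x - x₀‖ < R₂'},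
            ‖FluidPDE.curl (u t) x‖ ^ 2
          ≤ k / (2 * r) * ∫ t in (0)..T, ∫ x in {x : EuclideanSpace ℝ (Fin 3) | R₁' < ‖x - x₀‖ ∧ ‖x - x₀‖ < R₂'},
            ‖FluidPDE.curl (u t) x‖ ^ 2 := mul_le_mul_of_nonneg_right ha hI0
        _ ≤ k / (2 * r) * (κ2 * E) := mul_le_mul_of_nonneg_left hshT (by positivity)
    have h2 : k * (κ2 * E) / r ≤ δ ^ 2 / 9 := by
      rw [div_le_div_iff₀ hr (by norm_num : (0:ℝ) < 9)]
      have : 9 * c ^ (-(1 / 10 : ℝ)) * κ2 * E * δ ^ 2 ≤ r * δ ^ 2 :=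
        mul_le_mul_of_nonneg_right hEr.le (sq_nonneg δ)
      calc k * (κ2 * E) * 9 = 9 * c ^ (-(1 / 10 : ℝ)) * κ2 * E * δ ^ 2 := by rw [hk]; ring
        _ ≤ r * δ ^ 2 := this
        _ = δ ^ 2 * r := by ring
    have h3 : k / 2 * ((κ2 * E / (r / 4) + ε) + (κ2 * E / (r / 4) + ε)) + k / (2 * r) * (κ2 * E) =
        9 / 2 * (k * (κ2 * E) / r) + k * ε := by
      field_simp
      ring
    have h4 : δ ^ 2 ≤ K₁ * δ ^ 2 := le_mul_of_one_le_left (sq_nonneg δ) hK₁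
    have hmono : k / 2 * ((∫ t in (0)..T, (R₁' + speedIntegral u t / c) ^ 2 *
            sphereNormSq (FluidPDE.curl (u t)) x₀ (R₁' + speedIntegral u t / c)) +
          ∫ t in (0)..T, (R₂' - speedIntegral u t / c) ^ 2 *
            sphereNormSq (FluidPDE.curl (u t)) x₀ (R₂' - speedIntegral u t / c)) ≤
        k / 2 * ((κ2 * E / (r / 4) + ε) + (κ2 * E / (r / 4) + ε)) :=
      mul_le_mul_of_nonneg_left (add_le_add hT₁ hT₂) (by positivity)
    linarith [sq_nonneg δ]
  -- the continuity method
  obtain ⟨hWbd, hYbd⟩ := hstep hc hcc₀ hδ hT hδ4T (W := (fun s => localisedEnstrophy (movingCutoff x₀ k (fun t => R₁' + speedIntegral u t / c) (fun t => R₂' - speedIntegral u t / c) s) (u s))) (Y := (fun s => localisedEnstrophyDissipation (movingCutoff x₀ k (fun t => R₁' + speedIntegral u t / c) (fun t => R₂' - speedIntegral u t / c) s) (u s))) (a := fun _ => (0 : ℝ))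
    (b := (fun s => k / 2 * ((R₁' + speedIntegral u s / c) ^ 2 *
            sphereNormSq (FluidPDE.curl (u s)) x₀ (R₁' + speedIntegral u s / c) +
            (R₂' - speedIntegral u s / c) ^ 2 *
              sphereNormSq (FluidPDE.curl (u s)) x₀ (R₂' - speedIntegral u s / c)) +
          k / R₁' * ∫ x in {x : EuclideanSpace ℝ (Fin 3) | R₁' < ‖x - x₀‖ ∧ ‖x - x₀‖ < R₂'},
            ‖FluidPDE.curl (u s) x‖ ^ 2)) hWc hYc continuousOn_const hbc hW0' hY0' (fun _ _ => le_rfl) hb0' hW0K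
    (by simp; positivity) hIb (fun t ht => hineq t ht)
  -- extraction of the conclusion on the plateau annulus
  have hP : MeasurableSet (Metric.ball x₀ (R₂ - r) \ Metric.ball x₀ (R₁ + r)) :=
    measurableSet_ball.diff measurableSet_ball
  have hone : ∀ t ∈ Icc 0 T, ∀ x ∈ Metric.ball x₀ (R₂ - r) \ Metric.ball x₀ (R₁ + r),
      movingCutoff x₀ k (fun t => R₁' + speedIntegral u t / c) (fun t => R₂' - speedIntegral u t / c) t x = 1 := by
    intro t ht x hx
    rw [Set.mem_sdiff, Metric.mem_ball, Metric.mem_ball, not_lt, dist_eq_norm] at hx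
    refine movingCutoff_eq_one hk0 ?_ ?_
    · change R₁' + speedIntegral u t / c + k⁻¹ ≤ ‖x - x₀‖
      linarith [hx.2, hσcM t ht, hR₁'mem.2]
    · change ‖x - x₀‖ ≤ R₂' - speedIntegral u t / c - k⁻¹
      linarith [hx.1, hσcM t ht, hR₂'mem.1]
  refine ⟨fun t ht => ?_, ?_⟩
  · have h1 := setLIntegral_curl_sq_le_ofReal_localisedEnstrophy (v := u t) hP
      (movingCutoff_nonneg x₀ k (fun t => R₁' + speedIntegral u t / c) (fun t => R₂' - speedIntegral u t / c) t)
      (hone t ht) (integrable_curl_sq_mul_movingCutoff hsol hk0.le ht)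
    refine h1.trans (ENNReal.ofReal_le_ofReal ?_)
    rw [hA2]
    have := hWbd t ht
    nlinarith [hL6, sq_nonneg δ]
  · have h1 : ∫⁻ t in Ioo 0 T, ∫⁻ x in Metric.ball x₀ (R₂ - r) \ Metric.ball x₀ (R₁ + r),
        ‖fderiv ℝ (FluidPDE.curl (u t)) x‖ₑ ^ 2 ≤ ∫⁻ t in Ioo 0 T, ENNReal.ofReal ((fun s => localisedEnstrophyDissipation (movingCutoff x₀ k (fun t => R₁' + speedIntegral u t / c) (fun t => R₂' - speedIntegral u t / c) s) (u s)) t) := by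
      refine setLIntegral_mono' measurableSet_Ioo fun t ht => ?_
      exact setLIntegral_fderiv_curl_sq_le_ofReal_dissipation (v := u t) hP
        (movingCutoff_nonneg x₀ k _ _ t) (hone t (Ioo_subset_Icc_self ht))
        (integrable_fderiv_curl_sq_mul_movingCutoff hsol hk0.le (Ioo_subset_Icc_self ht))
    refine h1.trans ?_
    have hYi : IntegrableOn (fun s => localisedEnstrophyDissipation (movingCutoff x₀ k (fun t => R₁' + speedIntegral u t / c) (fun t => R₂' - speedIntegral u t / c) s) (u s)) (Ioo 0 T) volume :=
      (hYc.integrableOn_compact isCompact_Icc).mono_set Ioo_subset_Icc_self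
    have hnn : 0 ≤ᵐ[volume.restrict (Ioo 0 T)] (fun s => localisedEnstrophyDissipation (movingCutoff x₀ k (fun t => R₁' + speedIntegral u t / c) (fun t => R₂' - speedIntegral u t / c) s) (u s)) :=
      (ae_restrict_iff' measurableSet_Ioo).2 (Eventually.of_forall fun t ht => hY0' t (Ioo_subset_Icc_self ht))
    rw [← ofReal_integral_eq_lintegral_ofReal hYi hnn, ← integral_Ioc_eq_integral_Ioo,
      ← intervalIntegral.integral_of_le hT.le]
    refine ENNReal.ofReal_le_ofReal ?_
    rw [hA2]
    exact hYbd

/-! ## Consequences: the leaf structure of Cor. 11.1 and Cor. 11.4 after this file -/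

/-- **Thm. 10.1, exterior form (Remark 10.6), a priori, unit viscosity — from the nonlinear
estimate** (annulus form and the proved passage to the exterior region by monotone
convergence, `tao2011_enstrophyLocalisation_exterior_apriori_unit_of_annulus`). [cite: Tao2011, Thm. 10.1 + Remark 10.6] -/
theorem tao2011_enstrophyLocalisation_exterior_apriori_unit_of_nonlinearEstimate
    (hY : tao2011_nonlinearEstimate) : tao2011_enstrophyLocalisation_exterior_apriori_unit :=
  tao2011_enstrophyLocalisation_exterior_apriori_unit_of_annulus
    (tao2011_enstrophyLocalisation_annulus_apriori_unit_of_nonlinearEstimate hY)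

/-- **Cor. 11.1 (bounded enstrophy) from the two remaining analytic leaves**: the nonlinear
estimate for `Y₆` (§10) and the total speed of the nonlinear Duhamel component (§9, Prop. 9.1);
Lemma 8.1 (`tao_finite_energy_smooth_energy_bound_holds`), the linear part of Prop. 9.1, the
Fourier step and all of §10 besides `Y₆` being theorems of the tree. [cite: Tao2011, Cor. 11.1] -/
theorem tao2011_boundedEnstrophy_of_nonlinearEstimate_of_duhamel (hY : tao2011_nonlinearEstimate)
    (hN : tao2011_duhamelNonlinearSpeed_unit) : tao2011_boundedEnstrophy :=
  tao2011_boundedEnstrophy_of_annulus_leaves tao_finite_energy_smooth_energy_bound_holds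
    (tao2011_boundedTotalSpeed_unit_of_apriori tao_finite_energy_smooth_energy_bound_holds
      (tao2011_boundedTotalSpeed_apriori_unit_of_duhamel hN))
    (tao2011_enstrophyLocalisation_annulus_apriori_unit_of_nonlinearEstimate hY)

/-- **Cor. 11.4 (as printed, in velocity form, and the duplicate vendoring
`tao_finite_energy_velocity_uniqueness`) from the two remaining analytic leaves** — the nonlinear
estimate for `Y₆` and the Duhamel-nonlinear total speed — via
`tao_unconditional_uniqueness_of_duhamel_leaves` with Lemma 8.1 discharged. [cite: Tao2011, Cor. 11.4 (Remark 11.3)] -/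
theorem tao_unconditional_uniqueness_of_nonlinear_duhamel_leaves (hY : tao2011_nonlinearEstimate)
    (hN : tao2011_duhamelNonlinearSpeed_unit) :
    tao_unconditional_uniqueness ∧ tao_unconditional_uniqueness_velocity ∧
      tao_finite_energy_velocity_uniqueness :=
  tao_unconditional_uniqueness_of_duhamel_leaves tao_finite_energy_smooth_energy_bound_holds hN
    (tao2011_enstrophyLocalisation_exterior_apriori_unit_of_nonlinearEstimate hY)

/-- **Cor. 11.4, velocity form, from the two remaining analytic leaves.** Discharging
`tao2011_nonlinearEstimate` and `tao2011_duhamelNonlinearSpeed_unit` turns this into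
`tao_unconditional_uniqueness_velocity_holds`. [cite: Tao2011, Cor. 11.4 (Remark 11.3)] -/
theorem tao_unconditional_uniqueness_velocity_of_nonlinearEstimate_of_duhamel
    (hY : tao2011_nonlinearEstimate) (hN : tao2011_duhamelNonlinearSpeed_unit) :
    tao_unconditional_uniqueness_velocity :=
  (tao_unconditional_uniqueness_of_nonlinear_duhamel_leaves hY hN).2.1

end Assembly


end Literature.Analysis.FluidPDE

end
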